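import Summits.QuantumFields.YangMills.Theorems.BalabanUVNodesN21ReadSetDisj

/-!
# N21 (NE7c), strategy s3 «alternative currency», file 35 — THE INTERIOR-LOCALITY CLAUSE (H-L) OF A (2.12) DATUM FAMILY, and files 22c ∕ 28 ∕ 29 ∕ 31 §5
# GENERIC IN THE FAMILY: KT-28's (LOC) holds, modulo numerics only, for EVERY interior-local family `𝔟` — instances r11's `𝔟ᴺ` (recovering 28–31) and
# the measurable `𝔟ᴺᴹ` of files 34a ∕ 34b

HEADER — WORK-UNIT METADATA.  Seat `pub-ymgap-dag-n21-e` (R141 (C) fan-out, node N21 = NE7c `T4IndicatorShell.ShellWeightBound`, strategy s3), g11, file 35;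
sequel of 31 (`…N21ReadSetDisj`).  Lane: `--kind definition --supports stmt-QuantumFields-20544 --as helper` (K3⁷ `SpineGivenEndpointR13SepCoPH`; one `def … : Prop`,
the clause (H-L), symmetric with def-R's (H-U) `Node00.LocalBgMeasurableBg`).  Count-neutral.

WHY.  Files 28 ∕ 29 ∕ 31 §5 state KT-28's (LOC) at the ONE family `𝔟ᴺ K k := normalise (bgFamOfRecord F N ν K k) _`; their proofs use of `normalise` exactly one
sentence, r11's INTERIOR LOCALITY `normalise_local`.  File 34b builds a second interior-local family `𝔟ᴺᴹ` (measurably normalised, (H-U) a theorem).  Rather than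
twin four files, this file DISPLAYS the sentence as a clause on a datum family and proves the four files' content ONCE for every family satisfying it.
* §0 `InteriorLocalBg F N ν 𝔟` — (H-L): at every torus `K`, level `k ≤ m + K` and cube datum `□^{≈4}`, data agreeing on `near 𝐁_k(□^{≈4})` give the same
  `(𝔟 K k).U 𝐁_k(□^{≈4})` off the far `Γ₀`-bonds; `interiorLocalBg_normalise` — IT HOLDS AT `𝔟ᴺ` (r11 `normalise_local`); `InteriorLocalBg.ukBox_congr_on` — (2.16)
  at support level for the family (r11 `ukBox_congr_on`).
* §1 (22c L2 ∕ L4 generic) `plaqHol_ukBox_congr_of_interiorLocal` · ★ `fibreIndep_supStat_ukBox_of_interiorLocal`.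
* §2 (28 N1 ∕ N1′ ∕ N3 ∕ N3′ generic) ★ `fibreIndep_recordStatBg` · `fibreIndep_chiSlotBg` · ★★ `fibreIndep_chiSeqBg_off` · `fibreIndep_chiSeqBg_offFactor`.
* §3 (29 G5′ ∕ G5″ generic: `hgeom` discharged by 29 `hgeom_record`) `fibreIndep_recordStatBg_of_numerics` · `fibreIndep_chiSeqBg_off_of_numerics`.
* §4 (31 §5 generic: (DISJ) discharged by 31 `not_mem_of_far`) ★ `fibreIndep_recordStatBg_of_far` · ★★ `fibreIndep_chiSeqBg_off_of_far` · ★★ `fibreIndep_chiSeqBg_off_of_far_fibOfSeq`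
  — KT-28's (LOC) MODULO NUMERICS ONLY for every interior-local family, OFF-set read off `Z` ∕ `Z′(sq)`.

HONEST FRAMING.  One clause + [folklore] bookkeeping: the proofs of 22c ∕ 28 ∕ 29 ∕ 31 §5 verbatim with `normalise_local` replaced by the displayed (H-L); nothing of
Bałaban's asserted; NE7c NOT PRINTED ∕ NOT proved; N21 NOT discharged; counts UNMOVED (typed 28∕28 · discharged 5∕27); count-neutral; one finite 𝕋⁴ at fixed `ε` — NOT
ℝ⁴ ∕ OS ∕ mass gap ∕ Clay.  No `sorry`, no `axiom`, no `instance`, no `notation`.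

CITATION HEADER (lean-in-tree rule 2026-08-18).  BY NAME: r11 `B14.Eq12InteriorLocality.normalise` ∕ `normalise_local` ∕ `Bj_standingRange` ∕ `near` ∕ `near_range` ∕ `farBonds` ∕
`plaqBonds` ∕ `plaqHol_congr` ∕ `plaqDetermined_plaqSmall`; r11 `B14.Eq216Concrete.ukBox` ∕ `ukBox_congr_on` ∕ `liftIter` ∕ `inputs`; r12 `B15DeterminingSets.AgreeOn` ∕ `Bj`;
def-R `Node00.BgFam` ∕ `bgFamOfRecord` ∕ `cubeEnl` ∕ `cubeSide` ∕ `cubeIndices` ∕ `RkOfRecord` ∕ `plaqInside` ∕ `bondsMeeting` ∕ `fibOfSeq` ∕ `zpOfSeq` ∕ `SeqOfRecord` ∕ `Stage7Numerics` ∕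
`TowerNumerics`; `B14.Eq218Concrete.Seq` ∕ `cubesIn`; 22b `fibreIndep_supStat_of_localPlaq`; 21 `fibreIndep_prod_fac_smallInd`; 29 `hgeom_record`; 31 `not_mem_of_far` ∕
`two_mul_pow_le_cubeSide` ∕ `mem_bondsMeeting_of_mem_fibOfSeq`; `T4DressedR.FibreIndep`; `T4IndicatorShell.smallInd`; `T4LipschitzLedger.Pol` ∕ `Pol.fac_small`.
Context only (SHAPE, nothing asserted): [Balaban1988Convergent] (1.2) p. 246, (2.12)–(2.13) p. 256, (2.16)–(2.18) p. 257; [Balaban1989LargeFieldI] (0.3) p. 176, (1.1) p. 177.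
-/

set_option autoImplicit false

noncomputable section

open Set
open scoped BigOperators

namespace Summit.QuantumFields.YangMills.Theorems.N21InteriorLocalBg

open Literature.MathematicalPhysics.QuantumFieldTheory.Balaban1983to89
open Literature.MathematicalPhysics.QuantumFieldTheory.Balaban1983to89.Node00
open T4Continuum B15DeterminingSets B14.Eq213DetSet B14.Eq216Concrete B14.Eq12InteriorLocality B14.Eq213MaximalDomains B15Eq112TorusCover
  B14DomainGeom B14.Eq218Concrete
open Literature.MathematicalPhysics.QuantumFieldTheory.Balaban1983to89.T4DressedR (FibreIndep)
open Literature.MathematicalPhysics.QuantumFieldTheory.Balaban1983to89.T4IndicatorShell (smallInd)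
open Literature.MathematicalPhysics.QuantumFieldTheory.Balaban1983to89.T4LipschitzLedger (Pol)
open Summit.QuantumFields.YangMills.Theorems.N21ThresholdMixtureRStepCommonBox (fibreIndep_prod_fac_smallInd)
open Summit.QuantumFields.YangMills.Theorems.N21ThresholdMixtureRStepLocalityPlaq (fibreIndep_supStat_of_localPlaq)
open Summit.QuantumFields.YangMills.Theorems.N21ChiSlotCubeGeometry (hgeom_record)
open Summit.QuantumFields.YangMills.Theorems.N21ReadSetDisj (not_mem_of_far two_mul_pow_le_cubeSide mem_bondsMeeting_of_mem_fibOfSeq)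

variable (F : T4Family) (N : ℕ) [NeZero N]

/-! ## §0 The clause (H-L): interior locality of a datum family at the determining sets of record -/

/-- **(H-L) INTERIOR LOCALITY OF A BACKGROUND-DATUM FAMILY**: at every torus `K`, level `k ≤ m + K` and cube datum `box4 = □^{≈4}`, two multi-scale data
agreeing on `near 𝐁_k(□^{≈4})` give the same (2.12) configuration `(𝔟 K k).U 𝐁_k(□^{≈4})` on every bond except the far `Γ₀`-bonds — r11's `normalise_local`
as a DISPLAYED clause on the family (the companion of def-R's (H-U) `LocalBgMeasurableBg`). [cite: Balaban1988Convergent, (1.2) p.246, (2.12) p.256] -/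
def InteriorLocalBg (ν : Stage7Numerics) (𝔟 : BgFam F N) : Prop :=
  ∀ (K k : ℕ) (box4 : Set (Site (F.P K) 0)), k ≤ (F.P K).m + (F.P K).K →
    ∀ X X' : MSField (F.P K) (SU N), AgreeOn (near (Bj ν.M₁ box4 k)) X X' →
      ∀ b, b ∉ farBonds (Bj ν.M₁ box4 k) → (𝔟 K k).U (Bj ν.M₁ box4 k) X b = (𝔟 K k).U (Bj ν.M₁ box4 k) X' b

/-- **(H-L) HOLDS AT r11's NORMALISED FAMILY `𝔟ᴺ`** (`normalise_local`, `Bj_standingRange`). [cite: Balaban1988Convergent, (1.2) p.246, (2.12) p.256] -/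
theorem interiorLocalBg_normalise (ν : Stage7Numerics) :
    InteriorLocalBg F N ν (fun K k => normalise (bgFamOfRecord F N ν K k) (plaqDetermined_plaqSmall _)) :=
  fun K _ box4 hk _ _ hX b hb => normalise_local (bgFamOfRecord F N ν K _) (plaqDetermined_plaqSmall _) (Bj_standingRange ν.M₁ box4 hk) hX b hb

variable {F N}

/-- **(2.16) AT SUPPORT LEVEL FOR AN INTERIOR-LOCAL FAMILY**: `U_{k,□}(V_k) = U_{k,□}(W_k)` off the far `Γ₀`-bonds of `𝐁_k(□^{∼4})` whenever `V_k = W_k` on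
`liftIter k (inputs (near 𝐁_k(□^{∼4})))` (r11 `ukBox_congr_on` with `hloc :=` (H-L)). [cite: Balaban1988Convergent, (2.16) p.257] -/
theorem InteriorLocalBg.ukBox_congr_on {ν : Stage7Numerics} {𝔟 : BgFam F N} (h : InteriorLocalBg F N ν 𝔟) (K k : ℕ) {box4 : Set (Site (F.P K) 0)}
    (hk : k ≤ (F.P K).m + (F.P K).K) {Vk Wk : GaugeField (F.P K) k (SU N)} (hVW : ∀ c ∈ liftIter k (inputs (near (Bj ν.M₁ box4 k))), Vk c = Wk c) :
    ∀ b₀ ∈ (farBonds (Bj ν.M₁ box4 k))ᶜ, ukBox (𝔟 K k) ν.M₁ box4 k Vk b₀ = ukBox (𝔟 K k) ν.M₁ box4 k Wk b₀ :=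
  B14.Eq216Concrete.ukBox_congr_on (𝔟 K k) ν.M₁ (near (Bj ν.M₁ box4 k)) (near_range (Bj_standingRange ν.M₁ box4 hk))
    (farBonds (Bj ν.M₁ box4 k))ᶜ (fun X X' hX b₀ hb₀ => h K k box4 hk X X' hX b₀ hb₀) hVW

/-! ## §1 22c (L2) ∕ (L4) for an interior-local family -/

/-- (L2) The plaquette variables `U_{k,□}(V)(∂p)` on plaquettes avoiding the far `Γ₀`-bonds depend on `V` only through the local read set
`liftIter k (inputs (near 𝐁_k(□^{≈4})))`. [cite: Balaban1988Convergent, (1.2) p.246, (2.16)–(2.17) p.257] -/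
theorem plaqHol_ukBox_congr_of_interiorLocal {ν : Stage7Numerics} {𝔟 : BgFam F N} (h : InteriorLocalBg F N ν 𝔟) (K k : ℕ)
    {box4 : Set (Site (F.P K) 0)} (hk : k ≤ (F.P K).m + (F.P K).K) {V W : GaugeField (F.P K) k (SU N)}
    (hVW : ∀ c ∈ liftIter k (inputs (near (Bj ν.M₁ box4 k))), V c = W c) {p : Plaq (F.P K) 0}
    (hp : ∀ b ∈ plaqBonds p, b ∉ farBonds (Bj ν.M₁ box4 k)) :
    GaugeField.plaqHol (ukBox (𝔟 K k) ν.M₁ box4 k V) p = GaugeField.plaqHol (ukBox (𝔟 K k) ν.M₁ box4 k W) p :=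
  plaqHol_congr fun b hb => h.ukBox_congr_on K k hk hVW b (hp b hb)

/-- ★ (L4) The block-sup statistic over plaquettes avoiding the far `Γ₀`-bonds of `𝐁_k(□^{≈4})` is fibre-independent of every fibre MISSING the local read set.
(22b `fibreIndep_supStat_of_localPlaq`.) [cite: Balaban1988Convergent, (2.16)–(2.17) p.257] -/
theorem fibreIndep_supStat_ukBox_of_interiorLocal {ν : Stage7Numerics} {𝔟 : BgFam F N} (h : InteriorLocalBg F N ν 𝔟) (K k : ℕ)
    [DecidableEq (PBond (F.P K) k)] {box4 : Set (Site (F.P K) 0)} (hk : k ≤ (F.P K).m + (F.P K).K)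
    (T : Set (Plaq (F.P K) 0)) (hT : ∀ p ∈ T, ∀ b ∈ plaqBonds p, b ∉ farBonds (Bj ν.M₁ box4 k)) (s : Finset (PBond (F.P K) k))
    (hdisj : ∀ c ∈ liftIter k (inputs (near (Bj ν.M₁ box4 k))), c ∉ s) :
    FibreIndep s fun V => ⨆ p : T, GaugeGroup.dist1 (GaugeField.plaqHol (ukBox (𝔟 K k) ν.M₁ box4 k V) p.1) :=
  fibreIndep_supStat_of_localPlaq (fun V (p : T) => GaugeField.plaqHol (ukBox (𝔟 K k) ν.M₁ box4 k V) p.1)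
    (fun u => ⨆ p : T, GaugeGroup.dist1 (u p)) s fun V y p =>
    plaqHol_ukBox_congr_of_interiorLocal h K k hk (fun c hc => by simp only [Function.updateFinset, dif_neg (hdisj c hc)]) (hT p.1 p.2)

/-! ## §2 28 (N1) ∕ (N1′) ∕ (N3) ∕ (N3′) for an interior-local family -/

variable (F N)

/-- ★ (N1) The block-sup statistic of cube `a` read through an interior-local family is fibre-independent of every fibre missing the local read set
`liftIter k (inputs (near 𝐁_k(□_a^{≈4})))` — (LOC) = (H-L), (DISJ) = `hdisj`, cube geometry = `hgeom`. [cite: Balaban1988Convergent, (2.12) p.256, (2.16)–(2.17) p.257] -/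
theorem fibreIndep_recordStatBg {𝔟 : BgFam F N} (ν : Stage7Numerics) (hL : InteriorLocalBg F N ν 𝔟) (g : ℕ → ℝ) (K k : ℕ) [DecidableEq (PBond (F.P K) k)]
    (hk : k ≤ (F.P K).m + (F.P K).K) (a : ↥(cubeIndices (F.P K) (cubeSide (F.P K).L ν.M₂ (RkOfRecord (F.P K).L ν.r (g k)) k)))
    (hgeom : ∀ p ∈ plaqInside (cubeEnl (F.P K) (cubeSide (F.P K).L ν.M₂ (RkOfRecord (F.P K).L ν.r (g k)) k) a 1), ∀ b ∈ plaqBonds p,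
      b ∉ farBonds (Bj ν.M₁ (cubeEnl (F.P K) (cubeSide (F.P K).L ν.M₂ (RkOfRecord (F.P K).L ν.r (g k)) k) a 4) k))
    (fib : Finset (PBond (F.P K) k))
    (hdisj : ∀ c ∈ liftIter k (inputs (near (Bj ν.M₁ (cubeEnl (F.P K) (cubeSide (F.P K).L ν.M₂ (RkOfRecord (F.P K).L ν.r (g k)) k) a 4) k))), c ∉ fib) :
    FibreIndep fib fun V : GaugeField (F.P K) k (SU N) =>
      ⨆ p : ↥(plaqInside (cubeEnl (F.P K) (cubeSide (F.P K).L ν.M₂ (RkOfRecord (F.P K).L ν.r (g k)) k) a 1)),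
        dist1 (GaugeField.plaqHol (ukBox (𝔟 K k) ν.M₁ (cubeEnl (F.P K) (cubeSide (F.P K).L ν.M₂ (RkOfRecord (F.P K).L ν.r (g k)) k) a 4) k V) p.1) :=
  fibreIndep_supStat_ukBox_of_interiorLocal hL K k hk _ hgeom fib hdisj

/-- (N1′) … hence so is the cube's χ-slot factor at ANY threshold `S` and polarity `pol`. [cite: Balaban1988Convergent, (2.17) p.257] -/
theorem fibreIndep_chiSlotBg {𝔟 : BgFam F N} (ν : Stage7Numerics) (hL : InteriorLocalBg F N ν 𝔟) (g : ℕ → ℝ) (K k : ℕ) [DecidableEq (PBond (F.P K) k)]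
    (hk : k ≤ (F.P K).m + (F.P K).K) (a : ↥(cubeIndices (F.P K) (cubeSide (F.P K).L ν.M₂ (RkOfRecord (F.P K).L ν.r (g k)) k)))
    (hgeom : ∀ p ∈ plaqInside (cubeEnl (F.P K) (cubeSide (F.P K).L ν.M₂ (RkOfRecord (F.P K).L ν.r (g k)) k) a 1), ∀ b ∈ plaqBonds p,
      b ∉ farBonds (Bj ν.M₁ (cubeEnl (F.P K) (cubeSide (F.P K).L ν.M₂ (RkOfRecord (F.P K).L ν.r (g k)) k) a 4) k))
    (fib : Finset (PBond (F.P K) k))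
    (hdisj : ∀ c ∈ liftIter k (inputs (near (Bj ν.M₁ (cubeEnl (F.P K) (cubeSide (F.P K).L ν.M₂ (RkOfRecord (F.P K).L ν.r (g k)) k) a 4) k))), c ∉ fib)
    (pol : Pol) (S : ℝ) :
    FibreIndep fib fun V : GaugeField (F.P K) k (SU N) =>
      pol.fac (smallInd (⨆ p : ↥(plaqInside (cubeEnl (F.P K) (cubeSide (F.P K).L ν.M₂ (RkOfRecord (F.P K).L ν.r (g k)) k) a 1)),
        dist1 (GaugeField.plaqHol (ukBox (𝔟 K k) ν.M₁
          (cubeEnl (F.P K) (cubeSide (F.P K).L ν.M₂ (RkOfRecord (F.P K).L ν.r (g k)) k) a 4) k V) p.1)) S) :=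
  fun V y => by
    have h := fibreIndep_recordStatBg F N ν hL g K k hk a hgeom fib hdisj V y
    dsimp only at h ⊢
    rw [h]

/-- ★★ (N3) **KT-28's (LOC) FOR AN INTERIOR-LOCAL FAMILY**: for every fibre `fib`, threshold vector `S` and polarity vector `pol`, the product over the OFF cubes of
`Ω_k(s)` — those `c ∉ On` whose local read set misses `fib` (`hoff`) — of `(pol c).fac (smallInd (stat c) (S c))` is fibre-independent of `fib`.
[cite: Balaban1988Convergent, (2.16)–(2.18) p.257; Balaban1989LargeFieldI, (0.3) p.176] -/
theorem fibreIndep_chiSeqBg_off {𝔟 : BgFam F N} (ν : Stage7Numerics) (hL : InteriorLocalBg F N ν 𝔟) (g : ℕ → ℝ) (K k : ℕ) [DecidableEq (PBond (F.P K) k)]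
    (hk : k ≤ (F.P K).m + (F.P K).K)
    (hgeom : ∀ (c : ↥(cubeIndices (F.P K) (cubeSide (F.P K).L ν.M₂ (RkOfRecord (F.P K).L ν.r (g k)) k))),
      ∀ p ∈ plaqInside (cubeEnl (F.P K) (cubeSide (F.P K).L ν.M₂ (RkOfRecord (F.P K).L ν.r (g k)) k) c 1), ∀ b ∈ plaqBonds p,
        b ∉ farBonds (Bj ν.M₁ (cubeEnl (F.P K) (cubeSide (F.P K).L ν.M₂ (RkOfRecord (F.P K).L ν.r (g k)) k) c 4) k))
    (fib : Finset (PBond (F.P K) k)) {D : ℕ → Set (Set (Site (F.P K) 0))} (s : Seq D k)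
    (On : Finset ↥(cubeIndices (F.P K) (cubeSide (F.P K).L ν.M₂ (RkOfRecord (F.P K).L ν.r (g k)) k)))
    (hoff : ∀ c ∈ cubesIn (fun a : ↥(cubeIndices (F.P K) (cubeSide (F.P K).L ν.M₂ (RkOfRecord (F.P K).L ν.r (g k)) k)) =>
        cubeEnl (F.P K) (cubeSide (F.P K).L ν.M₂ (RkOfRecord (F.P K).L ν.r (g k)) k) a 0) (s.Ω k), c ∉ On →
      ∀ x ∈ liftIter k (inputs (near (Bj ν.M₁ (cubeEnl (F.P K) (cubeSide (F.P K).L ν.M₂ (RkOfRecord (F.P K).L ν.r (g k)) k) c 4) k))), x ∉ fib)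
    (pol : ↥(cubeIndices (F.P K) (cubeSide (F.P K).L ν.M₂ (RkOfRecord (F.P K).L ν.r (g k)) k)) → Pol)
    (S : ↥(cubeIndices (F.P K) (cubeSide (F.P K).L ν.M₂ (RkOfRecord (F.P K).L ν.r (g k)) k)) → ℝ) :
    FibreIndep fib fun V : GaugeField (F.P K) k (SU N) =>
      ∏ c ∈ (cubesIn (fun a : ↥(cubeIndices (F.P K) (cubeSide (F.P K).L ν.M₂ (RkOfRecord (F.P K).L ν.r (g k)) k)) =>
          cubeEnl (F.P K) (cubeSide (F.P K).L ν.M₂ (RkOfRecord (F.P K).L ν.r (g k)) k) a 0) (s.Ω k)).filter (fun c => c ∉ On),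
        (pol c).fac (smallInd (⨆ p : ↥(plaqInside (cubeEnl (F.P K) (cubeSide (F.P K).L ν.M₂ (RkOfRecord (F.P K).L ν.r (g k)) k) c 1)),
          dist1 (GaugeField.plaqHol (ukBox (𝔟 K k) ν.M₁
            (cubeEnl (F.P K) (cubeSide (F.P K).L ν.M₂ (RkOfRecord (F.P K).L ν.r (g k)) k) c 4) k V) p.1)) (S c)) :=
  fibreIndep_prod_fac_smallInd fib _ pol
    (u := fun (c : ↥(cubeIndices (F.P K) (cubeSide (F.P K).L ν.M₂ (RkOfRecord (F.P K).L ν.r (g k)) k))) (V : GaugeField (F.P K) k (SU N)) =>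
      ⨆ p : ↥(plaqInside (cubeEnl (F.P K) (cubeSide (F.P K).L ν.M₂ (RkOfRecord (F.P K).L ν.r (g k)) k) c 1)),
        dist1 (GaugeField.plaqHol (ukBox (𝔟 K k) ν.M₁
          (cubeEnl (F.P K) (cubeSide (F.P K).L ν.M₂ (RkOfRecord (F.P K).L ν.r (g k)) k) c 4) k V) p.1))
    (fun c hc => fibreIndep_recordStatBg F N ν hL g K k hk c (hgeom c) fib (hoff c (Finset.mem_filter.1 hc).1 (Finset.mem_filter.1 hc).2)) S

/-- (N3′) … in particular the OFF FACTOR of FILE 19's `chiSeqOfRecordBg F N 𝔟 …` itself (all polarities `small`, threshold `ε_kη_k²`).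
[cite: Balaban1988Convergent, (2.17)–(2.18) p.257] -/
theorem fibreIndep_chiSeqBg_offFactor {𝔟 : BgFam F N} (ν : Stage7Numerics) (hL : InteriorLocalBg F N ν 𝔟) (g : ℕ → ℝ) (K k : ℕ)
    [DecidableEq (PBond (F.P K) k)] (hk : k ≤ (F.P K).m + (F.P K).K)
    (hgeom : ∀ (c : ↥(cubeIndices (F.P K) (cubeSide (F.P K).L ν.M₂ (RkOfRecord (F.P K).L ν.r (g k)) k))),
      ∀ p ∈ plaqInside (cubeEnl (F.P K) (cubeSide (F.P K).L ν.M₂ (RkOfRecord (F.P K).L ν.r (g k)) k) c 1), ∀ b ∈ plaqBonds p,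
        b ∉ farBonds (Bj ν.M₁ (cubeEnl (F.P K) (cubeSide (F.P K).L ν.M₂ (RkOfRecord (F.P K).L ν.r (g k)) k) c 4) k))
    (fib : Finset (PBond (F.P K) k)) {D : ℕ → Set (Set (Site (F.P K) 0))} (s : Seq D k)
    (On : Finset ↥(cubeIndices (F.P K) (cubeSide (F.P K).L ν.M₂ (RkOfRecord (F.P K).L ν.r (g k)) k)))
    (hoff : ∀ c ∈ cubesIn (fun a : ↥(cubeIndices (F.P K) (cubeSide (F.P K).L ν.M₂ (RkOfRecord (F.P K).L ν.r (g k)) k)) =>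
        cubeEnl (F.P K) (cubeSide (F.P K).L ν.M₂ (RkOfRecord (F.P K).L ν.r (g k)) k) a 0) (s.Ω k), c ∉ On →
      ∀ x ∈ liftIter k (inputs (near (Bj ν.M₁ (cubeEnl (F.P K) (cubeSide (F.P K).L ν.M₂ (RkOfRecord (F.P K).L ν.r (g k)) k) c 4) k))), x ∉ fib) :
    FibreIndep fib fun V : GaugeField (F.P K) k (SU N) =>
      ∏ c ∈ (cubesIn (fun a : ↥(cubeIndices (F.P K) (cubeSide (F.P K).L ν.M₂ (RkOfRecord (F.P K).L ν.r (g k)) k)) =>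
          cubeEnl (F.P K) (cubeSide (F.P K).L ν.M₂ (RkOfRecord (F.P K).L ν.r (g k)) k) a 0) (s.Ω k)).filter (fun c => c ∉ On),
        smallInd (⨆ p : ↥(plaqInside (cubeEnl (F.P K) (cubeSide (F.P K).L ν.M₂ (RkOfRecord (F.P K).L ν.r (g k)) k) c 1)),
          dist1 (GaugeField.plaqHol (ukBox (𝔟 K k) ν.M₁
            (cubeEnl (F.P K) (cubeSide (F.P K).L ν.M₂ (RkOfRecord (F.P K).L ν.r (g k)) k) c 4) k V) p.1)) (epsOfRecord ν g k * (F.P K).eta k ^ 2) := by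
  have h := fibreIndep_chiSeqBg_off F N ν hL g K k hk hgeom fib s On hoff (fun _ => Pol.small) (fun _ => epsOfRecord ν g k * (F.P K).eta k ^ 2)
  simpa only [Pol.fac_small] using h

/-! ## §3 29 (G5′) ∕ (G5″) for an interior-local family: `hgeom` discharged -/

/-- (G5′) (N1) WITH `hgeom` GONE, modulo `0 < k ≤ m + K`, `1 ≤ M₁`, `L·M₁ ≤ L^{k+1}M₂R_k` (29 `hgeom_record`).
[cite: Balaban1988Convergent, (2.12)–(2.13) p.256, (2.16)–(2.17) p.257] -/
theorem fibreIndep_recordStatBg_of_numerics {𝔟 : BgFam F N} (ν : Stage7Numerics) (hL : InteriorLocalBg F N ν 𝔟) (g : ℕ → ℝ) (K k : ℕ)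
    [DecidableEq (PBond (F.P K) k)] (hk : k ≤ (F.P K).m + (F.P K).K) (hk0 : 0 < k) (hM : 1 ≤ ν.M₁)
    (hnum : (F.P K).L * ν.M₁ ≤ cubeSide (F.P K).L ν.M₂ (RkOfRecord (F.P K).L ν.r (g k)) k)
    (a : ↥(cubeIndices (F.P K) (cubeSide (F.P K).L ν.M₂ (RkOfRecord (F.P K).L ν.r (g k)) k))) (fib : Finset (PBond (F.P K) k))
    (hdisj : ∀ c ∈ liftIter k (inputs (near (Bj ν.M₁ (cubeEnl (F.P K) (cubeSide (F.P K).L ν.M₂ (RkOfRecord (F.P K).L ν.r (g k)) k) a 4) k))), c ∉ fib) :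
    FibreIndep fib fun V : GaugeField (F.P K) k (SU N) =>
      ⨆ p : ↥(plaqInside (cubeEnl (F.P K) (cubeSide (F.P K).L ν.M₂ (RkOfRecord (F.P K).L ν.r (g k)) k) a 1)),
        dist1 (GaugeField.plaqHol (ukBox (𝔟 K k) ν.M₁ (cubeEnl (F.P K) (cubeSide (F.P K).L ν.M₂ (RkOfRecord (F.P K).L ν.r (g k)) k) a 4) k V) p.1) :=
  fibreIndep_recordStatBg F N ν hL g K k hk a (hgeom_record F ν g K k hk0 hM hnum a) fib hdisj

/-- (G5″) (N3) WITH `hgeom` GONE — binders left: `hoff` ((DISJ)), `0 < k ≤ m + K`, `1 ≤ M₁`, `L·M₁ ≤ L^{k+1}M₂R_k`.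
[cite: Balaban1988Convergent, (2.16)–(2.18) p.257; Balaban1989LargeFieldI, (0.3) p.176] -/
theorem fibreIndep_chiSeqBg_off_of_numerics {𝔟 : BgFam F N} (ν : Stage7Numerics) (hL : InteriorLocalBg F N ν 𝔟) (g : ℕ → ℝ) (K k : ℕ)
    [DecidableEq (PBond (F.P K) k)] (hk : k ≤ (F.P K).m + (F.P K).K) (hk0 : 0 < k) (hM : 1 ≤ ν.M₁)
    (hnum : (F.P K).L * ν.M₁ ≤ cubeSide (F.P K).L ν.M₂ (RkOfRecord (F.P K).L ν.r (g k)) k)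
    (fib : Finset (PBond (F.P K) k)) {D : ℕ → Set (Set (Site (F.P K) 0))} (s : Seq D k)
    (On : Finset ↥(cubeIndices (F.P K) (cubeSide (F.P K).L ν.M₂ (RkOfRecord (F.P K).L ν.r (g k)) k)))
    (hoff : ∀ c ∈ cubesIn (fun a : ↥(cubeIndices (F.P K) (cubeSide (F.P K).L ν.M₂ (RkOfRecord (F.P K).L ν.r (g k)) k)) =>
        cubeEnl (F.P K) (cubeSide (F.P K).L ν.M₂ (RkOfRecord (F.P K).L ν.r (g k)) k) a 0) (s.Ω k), c ∉ On →
      ∀ x ∈ liftIter k (inputs (near (Bj ν.M₁ (cubeEnl (F.P K) (cubeSide (F.P K).L ν.M₂ (RkOfRecord (F.P K).L ν.r (g k)) k) c 4) k))), x ∉ fib)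
    (pol : ↥(cubeIndices (F.P K) (cubeSide (F.P K).L ν.M₂ (RkOfRecord (F.P K).L ν.r (g k)) k)) → Pol)
    (S : ↥(cubeIndices (F.P K) (cubeSide (F.P K).L ν.M₂ (RkOfRecord (F.P K).L ν.r (g k)) k)) → ℝ) :
    FibreIndep fib fun V : GaugeField (F.P K) k (SU N) =>
      ∏ c ∈ (cubesIn (fun a : ↥(cubeIndices (F.P K) (cubeSide (F.P K).L ν.M₂ (RkOfRecord (F.P K).L ν.r (g k)) k)) =>
          cubeEnl (F.P K) (cubeSide (F.P K).L ν.M₂ (RkOfRecord (F.P K).L ν.r (g k)) k) a 0) (s.Ω k)).filter (fun c => c ∉ On),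
        (pol c).fac (smallInd (⨆ p : ↥(plaqInside (cubeEnl (F.P K) (cubeSide (F.P K).L ν.M₂ (RkOfRecord (F.P K).L ν.r (g k)) k) c 1)),
          dist1 (GaugeField.plaqHol (ukBox (𝔟 K k) ν.M₁
            (cubeEnl (F.P K) (cubeSide (F.P K).L ν.M₂ (RkOfRecord (F.P K).L ν.r (g k)) k) c 4) k V) p.1)) (S c)) :=
  fibreIndep_chiSeqBg_off F N ν hL g K k hk (hgeom_record F ν g K k hk0 hM hnum) fib s On hoff pol S

/-! ## §4 31 §5 for an interior-local family: (DISJ) discharged by the geometry — KT-28's (LOC) modulo numerics only -/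

/-- ★ (A2) **(N1) WITH (DISJ) DISCHARGED**: cube `a`'s block-sup statistic through an interior-local family is fibre-independent of every fibre
`fib ⊆ bondsMeeting k Z` as soon as `□_a^{≈7}` misses `Z` — binders left: `0 < k ≤ m + K`, `1 ≤ M₁`, `1 ≤ M₂`, `L·M₁ ≤ L^{k+1}M₂R_k` (31 `not_mem_of_far`).
[cite: Balaban1988Convergent, (2.12)–(2.13) p.256, (2.16)–(2.17) p.257; Balaban1989LargeFieldI, (0.3) p.176] -/
theorem fibreIndep_recordStatBg_of_far {𝔟 : BgFam F N} (ν : Stage7Numerics) (hL : InteriorLocalBg F N ν 𝔟) (g : ℕ → ℝ) (K k : ℕ)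
    [DecidableEq (PBond (F.P K) k)] (hk : k ≤ (F.P K).m + (F.P K).K) (hk0 : 0 < k) (hM : 1 ≤ ν.M₁) (hM₂ : 1 ≤ ν.M₂)
    (hnum : (F.P K).L * ν.M₁ ≤ cubeSide (F.P K).L ν.M₂ (RkOfRecord (F.P K).L ν.r (g k)) k)
    (a : ↥(cubeIndices (F.P K) (cubeSide (F.P K).L ν.M₂ (RkOfRecord (F.P K).L ν.r (g k)) k)))
    (Z : Set (Site (F.P K) 0)) (fib : Finset (PBond (F.P K) k)) (hfib : ∀ b ∈ fib, b ∈ bondsMeeting k Z)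
    (hZ : ∀ z ∈ Z, z ∉ cubeEnl (F.P K) (cubeSide (F.P K).L ν.M₂ (RkOfRecord (F.P K).L ν.r (g k)) k) a 7) :
    FibreIndep fib fun V : GaugeField (F.P K) k (SU N) =>
      ⨆ p : ↥(plaqInside (cubeEnl (F.P K) (cubeSide (F.P K).L ν.M₂ (RkOfRecord (F.P K).L ν.r (g k)) k) a 1)),
        dist1 (GaugeField.plaqHol (ukBox (𝔟 K k) ν.M₁ (cubeEnl (F.P K) (cubeSide (F.P K).L ν.M₂ (RkOfRecord (F.P K).L ν.r (g k)) k) a 4) k V) p.1) :=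
  fibreIndep_recordStatBg_of_numerics F N ν hL g K k hk hk0 hM hnum a fib
    (not_mem_of_far hk0 hk hM (two_mul_pow_le_cubeSide F ν g K k hM₂) a.1 Z fib hfib hZ)

/-- ★★ (A3) **KT-28's (LOC) FOR AN INTERIOR-LOCAL FAMILY MODULO NUMERICS ONLY**: for every fibre `fib ⊆ bondsMeeting k Z`, polarity and threshold vector, the
product of χ-slots over the cubes of `Ω_k(s)` outside a set `On` CONTAINING EVERY CUBE WHOSE `□^{≈7}` MEETS `Z` is fibre-independent of `fib`
(binders: `0 < k ≤ m + K`, `1 ≤ M₁`, `1 ≤ M₂`, `L·M₁ ≤ L^{k+1}M₂R_k`). [cite: Balaban1988Convergent, (2.16)–(2.18) p.257; Balaban1989LargeFieldI, (0.3) p.176, (1.1) p.177] -/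
theorem fibreIndep_chiSeqBg_off_of_far {𝔟 : BgFam F N} (ν : Stage7Numerics) (hL : InteriorLocalBg F N ν 𝔟) (g : ℕ → ℝ) (K k : ℕ)
    [DecidableEq (PBond (F.P K) k)] (hk : k ≤ (F.P K).m + (F.P K).K) (hk0 : 0 < k) (hM : 1 ≤ ν.M₁) (hM₂ : 1 ≤ ν.M₂)
    (hnum : (F.P K).L * ν.M₁ ≤ cubeSide (F.P K).L ν.M₂ (RkOfRecord (F.P K).L ν.r (g k)) k)
    (Z : Set (Site (F.P K) 0)) (fib : Finset (PBond (F.P K) k)) (hfib : ∀ b ∈ fib, b ∈ bondsMeeting k Z)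
    {D : ℕ → Set (Set (Site (F.P K) 0))} (s : Seq D k)
    (On : Finset ↥(cubeIndices (F.P K) (cubeSide (F.P K).L ν.M₂ (RkOfRecord (F.P K).L ν.r (g k)) k)))
    (hOn : ∀ c : ↥(cubeIndices (F.P K) (cubeSide (F.P K).L ν.M₂ (RkOfRecord (F.P K).L ν.r (g k)) k)), c ∉ On →
      ∀ z ∈ Z, z ∉ cubeEnl (F.P K) (cubeSide (F.P K).L ν.M₂ (RkOfRecord (F.P K).L ν.r (g k)) k) c 7)
    (pol : ↥(cubeIndices (F.P K) (cubeSide (F.P K).L ν.M₂ (RkOfRecord (F.P K).L ν.r (g k)) k)) → Pol)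
    (S : ↥(cubeIndices (F.P K) (cubeSide (F.P K).L ν.M₂ (RkOfRecord (F.P K).L ν.r (g k)) k)) → ℝ) :
    FibreIndep fib fun V : GaugeField (F.P K) k (SU N) =>
      ∏ c ∈ (cubesIn (fun a : ↥(cubeIndices (F.P K) (cubeSide (F.P K).L ν.M₂ (RkOfRecord (F.P K).L ν.r (g k)) k)) =>
          cubeEnl (F.P K) (cubeSide (F.P K).L ν.M₂ (RkOfRecord (F.P K).L ν.r (g k)) k) a 0) (s.Ω k)).filter (fun c => c ∉ On),
        (pol c).fac (smallInd (⨆ p : ↥(plaqInside (cubeEnl (F.P K) (cubeSide (F.P K).L ν.M₂ (RkOfRecord (F.P K).L ν.r (g k)) k) c 1)),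
          dist1 (GaugeField.plaqHol (ukBox (𝔟 K k) ν.M₁
            (cubeEnl (F.P K) (cubeSide (F.P K).L ν.M₂ (RkOfRecord (F.P K).L ν.r (g k)) k) c 4) k V) p.1)) (S c)) :=
  fibreIndep_chiSeqBg_off_of_numerics F N ν hL g K k hk hk0 hM hnum fib s On
    (fun c _ hc => not_mem_of_far hk0 hk hM (two_mul_pow_le_cubeSide F ν g K k hM₂) c.1 Z fib hfib (hOn c hc)) pol S

/-- ★★ (A5) **ONE APPLICATION AT def-R's FIBRE**: (A3) with `fib := fibOfSeq F ν τ p g k sq` and `Z := Z′(sq) = zpOfSeq …`.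
[cite: Balaban1988Convergent, (2.16)–(2.18) p.257; Balaban1989LargeFieldI, (0.3) p.176, (1.1) p.177] -/
theorem fibreIndep_chiSeqBg_off_of_far_fibOfSeq {𝔟 : BgFam F N} (ν : Stage7Numerics) (hL : InteriorLocalBg F N ν 𝔟) (τ : TowerNumerics) (p : B12.RunParams)
    (g : ℕ → ℝ) (k : ℕ) [DecidableEq (PBond (F.P p.K) k)]
    (hk : k ≤ (F.P p.K).m + (F.P p.K).K) (hk0 : 0 < k) (hM : 1 ≤ ν.M₁) (hM₂ : 1 ≤ ν.M₂)
    (hnum : (F.P p.K).L * ν.M₁ ≤ cubeSide (F.P p.K).L ν.M₂ (RkOfRecord (F.P p.K).L ν.r (g k)) k)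
    (sq : SeqOfRecord F ν τ.M g p.K k) {D : ℕ → Set (Set (Site (F.P p.K) 0))} (s : Seq D k)
    (On : Finset ↥(cubeIndices (F.P p.K) (cubeSide (F.P p.K).L ν.M₂ (RkOfRecord (F.P p.K).L ν.r (g k)) k)))
    (hOn : ∀ c : ↥(cubeIndices (F.P p.K) (cubeSide (F.P p.K).L ν.M₂ (RkOfRecord (F.P p.K).L ν.r (g k)) k)), c ∉ On →
      ∀ z ∈ zpOfSeq F ν τ g p.K k sq, z ∉ cubeEnl (F.P p.K) (cubeSide (F.P p.K).L ν.M₂ (RkOfRecord (F.P p.K).L ν.r (g k)) k) c 7)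
    (pol : ↥(cubeIndices (F.P p.K) (cubeSide (F.P p.K).L ν.M₂ (RkOfRecord (F.P p.K).L ν.r (g k)) k)) → Pol)
    (S : ↥(cubeIndices (F.P p.K) (cubeSide (F.P p.K).L ν.M₂ (RkOfRecord (F.P p.K).L ν.r (g k)) k)) → ℝ) :
    FibreIndep (fibOfSeq F ν τ p g k sq) fun V : GaugeField (F.P p.K) k (SU N) =>
      ∏ c ∈ (cubesIn (fun a : ↥(cubeIndices (F.P p.K) (cubeSide (F.P p.K).L ν.M₂ (RkOfRecord (F.P p.K).L ν.r (g k)) k)) =>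
          cubeEnl (F.P p.K) (cubeSide (F.P p.K).L ν.M₂ (RkOfRecord (F.P p.K).L ν.r (g k)) k) a 0) (s.Ω k)).filter (fun c => c ∉ On),
        (pol c).fac (smallInd (⨆ q : ↥(plaqInside (cubeEnl (F.P p.K) (cubeSide (F.P p.K).L ν.M₂ (RkOfRecord (F.P p.K).L ν.r (g k)) k) c 1)),
          dist1 (GaugeField.plaqHol (ukBox (𝔟 p.K k) ν.M₁
            (cubeEnl (F.P p.K) (cubeSide (F.P p.K).L ν.M₂ (RkOfRecord (F.P p.K).L ν.r (g k)) k) c 4) k V) q.1)) (S c)) :=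
  fibreIndep_chiSeqBg_off_of_far F N ν hL g p.K k hk hk0 hM hM₂ hnum (zpOfSeq F ν τ g p.K k sq) (fibOfSeq F ν τ p g k sq)
    (fun _ hb => mem_bondsMeeting_of_mem_fibOfSeq F ν τ p g k sq hb) s On hOn pol S

end Summit.QuantumFields.YangMills.Theorems.N21InteriorLocalBg

end
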